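import Summits.BirchSwinnertonDyer.BirchSwinnertonDyer.Theorems.EisensteinPrimesResidualDevissageFiniteKernel
import HarnessLib

/-!
# The residual dévissage COUNTED (upper half): `#R_𝔭^Σ(K_∞, B) ≤ #R_𝔭^Σ(K_∞, A) · #R_𝔭^Σ(K_∞, C) · #C^{p^c}`
# along `0 → A → B → C → 0` with `C` finite (cell `bsd-eis`, seat `bsd-line-x2-p2` gen 5, D-0154 KEY row 5;
# crux 4 `BSDpOnCellC` line b1 — the `λ`-side of the reducible dévissage; counting twin of p628626)

HONEST FRAMING (cell `bsd-eis`, run/shared/lean/pub/bsd-eis/): pure Galois-cohomology bookkeeping on constructed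
objects (no definition, no named fact, no `sorry`, no `Theses` import); nothing about any curve is asserted;
nothing booked; no label or count moves; BSD and the main conjectures are proved for NO curve. Helper
`--supports stmt-BirchSwinnertonDyer-19034`; closes no registered stub.

## Why

On line b1 of crux 4 the wall `stub_imprimitiveCount` (`λ(𝓛^S_f) ≤ λ(𝔛^S_f)`) is reached in print only THROUGH
the `λ`-identity of Keller–Yin Thm. 1.4.1, `λ(𝔛^S_f) [+1] = λ(𝔛^S_φ) + λ(𝔛^S_ψ)` along `0 → 𝔽(φ) → E[p] → 𝔽(ψ) → 0`
(KY §5.1 transfers `λ(𝔛^S_f) = λ(𝔛^S_{f_m})` through it at `p ‖ N`; the Greenberg–Vatsal / CGLS count uses it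
directly) — an E-level PREPRINT step whose finiteness / `μ = 0` half is kernel since p628626 / p629595. Its
residual currency is a COUNT of the groups `R(·) = R_𝔭^Σ(K_∞, ·) := GreenbergVatsal2000.datumStrictSelmer (ker κ) ·
p (AcSelmer.bdpData · p 𝔭) Σ` along the dévissage. p628626 proved `R(A), R(C)` finite ⟹ `R(B)` finite; this file
says HOW BIG (upper half; the lower half and the curve assembly are in `…ResidualDevissageCountLower`):

* §0 `natCard_eq_card_ker_mul_card_range` — `#Y = #ker g · #g(Y)` (first isomorphism theorem, `Nat.card`).
* §1 `natCard_ker_resH1Hom_id_le` — `#ker(j_* : H¹(G, A) → H¹(G, B)) ≤ #C` for exact `0 → A —j→ B —q→ C`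
  (the connecting map `[φ] ↦ q b`, `j ∘ φ = ∂b`, injects; count form of p628626 §1); `resH1Hom_id_comp_eq_zero`:
  `q_* ∘ j_* = 0` when `q ∘ j = 0`.
* §2 `natCard_comap_datumStrictSelmer_le` — with `p^c` elements `τ i ∈ Γ_K` controlling the strict condition at
  every place above `𝔭` (hypothesis `hreps` = the conclusion of `forall_resOfLe_conjH1_eq_zero_of_reps`, Brink),
  (U) at the good places outside `Σ`, and `T = ker(j_* on H¹(H ⊓ D_𝔭, A))`:
  **`#j_*⁻¹(R(B)) ≤ #R(A) · #T^{p^c}`** (the signature map `x ↦ (res_{H ⊓ D_𝔭} conj_{τ i} x)_i` of p628626 §2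
  has kernel inside `R(A)` and values in `T^{p^c}`; count through it).
* §3 `natCard_datumStrictSelmer_le_of_devissage` — **`#R(B) ≤ #R(A) · #R(C) · #C^{p^c}`**, UNCONDITIONAL
  (`q_*` maps `R(B)` to `R(C)` with kernel inside `j_*(j_*⁻¹ R(B))` by the middle exactness of
  `H¹(A) → H¹(B) → H¹(C)`; then §2, and §1 at `H ⊓ D_𝔭` for `#T ≤ #C`).

In `𝔽_p`-dimensions (everything is `p`-torsion when `A, B, C` are): `d R(B) ≤ d R(A) + d R(C) + p^c · d C`, the
«`≤`» half of the residual `λ`-count with the local error `p^c · d C` (`p^c` ≥ the number of places of `K_∞`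
above `𝔭`). With the tree's Kummer comparison `#R(E[p]) = #Sel_𝔭^Σ(K_∞, E[p^∞])[p]`
(`UniversalToricDescentResidualSelmerExact`) and Herbrand count `#(X/pX) = p^{λ(X)} · #X[p]`
(`…LambdaHerbrandCount`) this is the residual form of `λ(𝔛^S_f) ≤ λ(𝔛^S_φ) + λ(𝔛^S_ψ) + O(1)`.

References: [KellerYin2024] Thm. 1.4.1 and its proof (Lemmas `Seltolambda`, `SelfSelomega`), §5.1
(arXiv:2402.12781v2); [GreenbergVatsal2000] §2 pp. 20–26 (Prop. 2.8, the two-curve count);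
[CastellaGrossiLeeSkinner2022] Prop. 17 (arXiv:2008.02571 §1.4); [SerreGaloisCohomology1997] I.§2.2, I.§5.4;
[LimSujatha2018] §3 Prop. 3.2; [Brink2007] Cor. 1; cell p628626 (g4), p609974, p613183 (UTD / CHL).
-/

set_option autoImplicit false
set_option linter.dupNamespace false -- the summit namespace `…BirchSwinnertonDyer.BirchSwinnertonDyer.Theorems` (Sub = Summit, D-0017) trips it

noncomputable section

open scoped Classical

universe u

namespace Summit.BirchSwinnertonDyer.BirchSwinnertonDyer.Theorems.ResidualDevissageCount

open Literature.NumberTheory.EllipticCurves Literature.NumberTheory.EllipticCurves.GreenbergSelmer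
  Literature.NumberTheory.EllipticCurves.GreenbergVatsal2000 Literature.NumberTheory.GaloisRepresentations
  Literature.NumberTheory.EllipticCurves.FineSelmerCoefficientMap
  NumberField IsDedekindDomain Field WeierstrassCurve
  Summit.BirchSwinnertonDyer.Rank1Residual.X11b Summit.BirchSwinnertonDyer.Rank1Residual.X11b.AcSelmer
  Summit.BirchSwinnertonDyer.Rank1Residual.X2.ResidualDevissageModules
  Summit.BirchSwinnertonDyer.BirchSwinnertonDyer.Theorems.UniversalToricDescentResidualSelmer
  Summit.BirchSwinnertonDyer.BirchSwinnertonDyer.Theorems.UniversalToricDescentResidualSelmerFinite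
  Summit.BirchSwinnertonDyer.BirchSwinnertonDyer.Theorems.CumulativeHeegnerInclusionAtThreeStubB1Devissage
  Summit.BirchSwinnertonDyer.BirchSwinnertonDyer.Theorems.CumulativeHeegnerInclusionAtThreeStubB1DevissageNamed
  Summit.BirchSwinnertonDyer.BirchSwinnertonDyer.Theorems.CumulativeHeegnerInclusionAtThreeResidualDevissage
  Summit.BirchSwinnertonDyer.BirchSwinnertonDyer.Theorems.ResidualDevissageFiniteKernel

/-! ### §0 Counting through a homomorphism -/

section Count

/-- **`#Y = #ker g · #g(Y)`** for an additive homomorphism (first isomorphism theorem; `Nat.card`, no finiteness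
needed). [folklore] -/
theorem natCard_eq_card_ker_mul_card_range {Y Z : Type*} [AddCommGroup Y] [AddCommGroup Z] (g : Y →+ Z) :
    Nat.card Y = Nat.card g.ker * Nat.card g.range := by
  rw [AddSubgroup.card_eq_card_quotient_mul_card_addSubgroup g.ker,
    Nat.card_congr (QuotientAddGroup.quotientKerEquivRange g).toEquiv, mul_comm]

/-- `#(Fin n → T) = #T ^ n`. [folklore] -/
theorem natCard_fin_fun (n : ℕ) (T : Type*) : Nat.card (Fin n → T) = Nat.card T ^ n := by
  rw [Nat.card_fun, Nat.card_eq_fintype_card (α := Fin n), Fintype.card_fin]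

end Count

/-! ### §1 `#ker(j_* : H¹(G, A) → H¹(G, B)) ≤ #C` -/

section Kernel

variable {G : Type u} [Group G] [TopologicalSpace G] [IsTopologicalGroup G]
variable {A : Type u} [AddCommGroup A] [DistribMulAction G A] [TopologicalSpace A] [DiscreteTopology A]
variable {B : Type u} [AddCommGroup B] [DistribMulAction G B] [TopologicalSpace B] [DiscreteTopology B]
variable {C : Type u} [AddCommGroup C]

/-- **`#ker(j_* : H¹(G, A) → H¹(G, B)) ≤ #C`** for an exact `0 → A —j→ B —q→ C` with `C` finite (`j` injective,
`ker q ⊆ im j`): the connecting map `[φ] ↦ q b` (`j ∘ φ = ∂b`) is an injection of the kernel into `C` (as in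
p628626 §1, which records only the finiteness). [cite: SerreGaloisCohomology1997, I.§2.2 (Prop. 2) and I.§5.4] -/
theorem natCard_ker_resH1Hom_id_le [Finite C] (j : A →+ B)
    (hj : ∀ (g : G) (a : A), j (ContinuousMonoidHom.id G g • a) = g • j a) (hinj : Function.Injective j)
    (q : B →+ C) (hexact : ∀ b : B, q b = 0 → ∃ a : A, j a = b) :
    Nat.card {y : discreteH1 G A // resH1Hom (ContinuousMonoidHom.id G) j hj y = 0} ≤ Nat.card C := by
  have hj' : ∀ (g : G) (a : A), j (g • a) = g • j a := hj
  have hrep : ∀ y : {y : discreteH1 G A // resH1Hom (ContinuousMonoidHom.id G) j hj y = 0},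
      ∃ φ : contOneCocycles (discreteTopRep G A), ∃ b : B,
        oneCocycleClass _ φ = y.1 ∧ ∀ g : G, j (φ.1 g) = g • b - b := by
    intro y
    obtain ⟨φ, hφ⟩ := oneCocycleClass_surjective _ y.1
    have h0 := y.2
    rw [← hφ, resH1Hom_id_oneCocycleClass, oneCocycleClass_eq_zero_iff] at h0
    obtain ⟨b, hb⟩ := h0
    exact ⟨φ, b, hφ, fun g ↦ hb g⟩
  choose φ b hφ hb using hrep
  have hf : Function.Injective fun y : {y : discreteH1 G A //
      resH1Hom (ContinuousMonoidHom.id G) j hj y = 0} ↦ q (b y) := by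
    intro y y' h
    have hq0 : q (b y - b y') = 0 := by
      have h' : q (b y) = q (b y') := h
      rw [map_sub, h', sub_self]
    obtain ⟨a₀, ha₀⟩ := hexact _ hq0
    apply Subtype.ext
    rw [← hφ y, ← hφ y', ← sub_eq_zero, ← oneCocycleClass_sub, oneCocycleClass_eq_zero_iff]
    refine ⟨a₀, fun g ↦ hinj ?_⟩
    change j (((φ y) - (φ y')).1 g) = j (g • a₀ - a₀)
    rw [Submodule.coe_sub, ContinuousMap.sub_apply, map_sub, hb, hb, map_sub, hj', ha₀, smul_sub]
    abel
  exact Nat.card_le_card_of_injective _ hf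

/-- **`q_* ∘ j_* = 0` on `H¹(G, ·)`** when `q ∘ j = 0` (the pushed cocycle `q ∘ j ∘ φ` is identically zero).
[cite: SerreGaloisCohomology1997, I.§2.2] -/
theorem resH1Hom_id_comp_eq_zero {C' : Type u} [AddCommGroup C'] [DistribMulAction G C'] [TopologicalSpace C']
    [DiscreteTopology C'] (j : A →+ B)
    (hj : ∀ (g : G) (a : A), j (ContinuousMonoidHom.id G g • a) = g • j a) (q : B →+ C')
    (hq : ∀ (g : G) (b : B), q (ContinuousMonoidHom.id G g • b) = g • q b) (hqj : ∀ a : A, q (j a) = 0)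
    (y : discreteH1 G A) :
    resH1Hom (ContinuousMonoidHom.id G) q hq (resH1Hom (ContinuousMonoidHom.id G) j hj y) = 0 := by
  obtain ⟨φ, rfl⟩ := oneCocycleClass_surjective _ y
  rw [resH1Hom_id_oneCocycleClass, resH1Hom_id_oneCocycleClass, oneCocycleClass_eq_zero_iff]
  refine ⟨0, fun g ↦ ?_⟩
  change q (j (φ.1 g)) = g • (0 : C') - 0
  rw [hqj, smul_zero, sub_zero]

end Kernel

/-! ### §2 `#j_*⁻¹(R_𝔭^Σ(K_∞, B)) ≤ #R_𝔭^Σ(K_∞, A) · #T^{p^c}` -/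

section Residual

variable {K : Type} [Field K] [NumberField K] {p : ℕ} [Fact p.Prime] (κ : ZpExtension K p)
  (𝔭 : HeightOneSpectrum (𝓞 K)) (S₀ : Set (HeightOneSpectrum (𝓞 K)))

variable {A : Type} [AddCommGroup A] [DistribMulAction (absoluteGaloisGroup K) A] [TopologicalSpace A]
  [DiscreteTopology A]
variable {B : Type} [AddCommGroup B] [DistribMulAction (absoluteGaloisGroup K) B] [TopologicalSpace B]
  [DiscreteTopology B]
variable {C : Type} [AddCommGroup C] [DistribMulAction (absoluteGaloisGroup K) C] [TopologicalSpace C]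
  [DiscreteTopology C]

/-- **`j_*⁻¹(R_𝔭^Σ(K_∞, B))` is finite with `#j_*⁻¹(R(B)) ≤ #R(A) · #T^{p^c}`**, where `T` is the kernel of `j_*`
on `H¹(H ⊓ D_𝔭, A)` (`H = ker κ`), given: `p^c` elements `τ i ∈ Γ_K` whose conjugates control the strict condition
at every place above `𝔭` (`hreps`, = the conclusion of `forall_resOfLe_conjH1_eq_zero_of_reps` — Brink's finite
decomposition), (U) `j_*` injective on the inertia cohomology at the good places outside `Σ`, `T` finite and
`R(A)` finite. The signature map `Ψ x = (res_{H ⊓ D_𝔭} conj_{τ i} x)_{i < p^c}` sends `j_*⁻¹ R(B)` into `T^{p^c}`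
and its kernel there lies in `R(A)` (p628626 §2); count through `Ψ` (§0).
[cite: GreenbergLNM1716, §3 (Lemmas 3.1–3.3)] [cite: LimSujatha2018, §3 (proof of Prop. 3.2)]
[cite: CastellaGrossiLeeSkinner2022, Prop. 17 (arXiv:2008.02571 §1.4)] -/
theorem natCard_comap_datumStrictSelmer_le (h𝔭 : ((p : ℕ) : 𝓞 K) ∈ 𝔭.asIdeal)
    (j : A →+ B) (hj' : ∀ (σ : absoluteGaloisGroup K) (a : A), j (σ • a) = σ • j a)
    (hU : ∀ v : HeightOneSpectrum (𝓞 K), v ∉ S₀ → ((p : ℕ) : 𝓞 K) ∉ v.asIdeal →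
      Function.Injective
        (resH1Hom (ContinuousMonoidHom.id (inertiaIn κ.kerSubgroup v)) j (fun _ a ↦ hj' _ a)))
    (c : ℕ) (τ : ℕ → absoluteGaloisGroup K)
    (hreps : ∀ x : Literature.NumberTheory.EllipticCurves.subgroupH1 κ.kerSubgroup A,
      (∀ i, i < p ^ c → resOfLe A (inf_le_left : κ.kerSubgroup ⊓ decomp 𝔭 ≤ κ.kerSubgroup)
        (conjH1 κ.kerSubgroup A (τ i) x) = 0) →
      ∀ σ : absoluteGaloisGroup K, resOfLe A (inf_le_left : κ.kerSubgroup ⊓ decomp 𝔭 ≤ κ.kerSubgroup)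
        (conjH1 κ.kerSubgroup A σ x) = 0)
    (hT : Set.Finite {y : Literature.NumberTheory.EllipticCurves.subgroupH1 (κ.kerSubgroup ⊓ decomp 𝔭) A |
      resH1Hom (ContinuousMonoidHom.id ↥(κ.kerSubgroup ⊓ decomp 𝔭)) j (fun _ a ↦ hj' _ a) y = 0})
    (hA : (datumStrictSelmer κ.kerSubgroup A p (AcSelmer.bdpData A p 𝔭) S₀ :
      Set (Literature.NumberTheory.EllipticCurves.subgroupH1 κ.kerSubgroup A)).Finite) :
    Finite ((datumStrictSelmer κ.kerSubgroup B p (AcSelmer.bdpData B p 𝔭) S₀).comap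
        (resH1Hom (ContinuousMonoidHom.id κ.kerSubgroup) j (fun _ a ↦ hj' _ a))) ∧
      Nat.card ((datumStrictSelmer κ.kerSubgroup B p (AcSelmer.bdpData B p 𝔭) S₀).comap
          (resH1Hom (ContinuousMonoidHom.id κ.kerSubgroup) j (fun _ a ↦ hj' _ a))) ≤
        Nat.card (datumStrictSelmer κ.kerSubgroup A p (AcSelmer.bdpData A p 𝔭) S₀) *
          Nat.card {y : Literature.NumberTheory.EllipticCurves.subgroupH1 (κ.kerSubgroup ⊓ decomp 𝔭) A //
            resH1Hom (ContinuousMonoidHom.id ↥(κ.kerSubgroup ⊓ decomp 𝔭)) j (fun _ a ↦ hj' _ a) y = 0} ^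
            (p ^ c) := by
  -- notation
  let H := κ.kerSubgroup
  let jH := resH1Hom (ContinuousMonoidHom.id H) j (fun _ a ↦ hj' _ a)
  let jD := resH1Hom (ContinuousMonoidHom.id ↥(H ⊓ decomp 𝔭)) j (fun _ a ↦ hj' _ a)
  have hconj : ∀ (σ : absoluteGaloisGroup K) (x : Literature.NumberTheory.EllipticCurves.subgroupH1 H A),
      conjH1 H B σ (jH x) = jH (conjH1 H A σ x) := fun σ x ↦
    congrArg (fun f : Literature.NumberTheory.EllipticCurves.subgroupH1 H A →+
        Literature.NumberTheory.EllipticCurves.subgroupH1 H B ↦ f x)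
      (conjH1_comp_resH1Hom_id H j (fun _ a ↦ hj' _ a) hj' σ)
  let resp : Literature.NumberTheory.EllipticCurves.subgroupH1 H A →+
      Literature.NumberTheory.EllipticCurves.subgroupH1 (H ⊓ decomp 𝔭) A :=
    resOfLe A (inf_le_left : H ⊓ decomp 𝔭 ≤ H)
  have hres : ∀ x : Literature.NumberTheory.EllipticCurves.subgroupH1 H A,
      resOfLe B (inf_le_left : H ⊓ decomp 𝔭 ≤ H) (jH x) = jD (resp x) := fun x ↦ by
    have e := congrArg (fun f : Literature.NumberTheory.EllipticCurves.subgroupH1 H A →+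
        Literature.NumberTheory.EllipticCurves.subgroupH1 (H ⊓ decomp 𝔭) B ↦ f x)
      (resOfLe_comp_resH1Hom_id (inf_le_left : H ⊓ decomp 𝔭 ≤ H) j (fun _ a ↦ hj' _ a)
        (fun _ a ↦ hj' _ a))
    simpa only [AddMonoidHom.comp_apply] using e
  -- the signature map
  let Ψ : Literature.NumberTheory.EllipticCurves.subgroupH1 H A →+
      (Fin (p ^ c) → Literature.NumberTheory.EllipticCurves.subgroupH1 (H ⊓ decomp 𝔭) A) :=
    { toFun := fun x i ↦ resp (conjH1 H A (τ i) x)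
      map_zero' := by ext i; simp
      map_add' := fun x y ↦ by ext i; simp }
  -- `Y = j_*⁻¹ R(B)`
  let Y : AddSubgroup (Literature.NumberTheory.EllipticCurves.subgroupH1 H A) :=
    (datumStrictSelmer H B p (AcSelmer.bdpData B p 𝔭) S₀).comap jH
  have hYmem : ∀ x, x ∈ Y ↔ jH x ∈ datumStrictSelmer H B p (AcSelmer.bdpData B p 𝔭) S₀ := fun x ↦ Iff.rfl
  -- (a) on `Y`, `Ψ` takes values in the kernel `T`
  have hΨker : ∀ x ∈ Y, ∀ i : Fin (p ^ c), jD (Ψ x i) = 0 := by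
    intro x hx i
    change jD (resp (conjH1 H A (τ i) x)) = 0
    rw [← hres, ← hconj]
    have h := ((mem_datumStrictSelmer_iff _).mp ((hYmem x).mp hx)).2 𝔭 h𝔭 (τ i)
    rw [AcSelmer.bdpData_self p 𝔭 h𝔭, mem_strictKer_strictDatum_iff] at h
    exact h
  -- (b) the kernel of `Ψ` on `Y` lies in `R(A)`
  have hΨzero : ∀ x ∈ Y, Ψ x = 0 → x ∈ datumStrictSelmer H A p (AcSelmer.bdpData A p 𝔭) S₀ := by
    intro x hx hΨ
    have hxB := (mem_datumStrictSelmer_iff _).mp ((hYmem x).mp hx)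
    rw [mem_unramifiedOutside_iff] at hxB
    rw [mem_datumStrictSelmer_iff, mem_unramifiedOutside_iff]
    refine ⟨fun v hvS hvp σ ↦ ?_, fun v hv σ ↦ ?_⟩
    · -- unramified at the good `v ∉ Σ`: (U)
      have h := hxB.1 v hvS hvp σ
      rw [hconj, GreenbergVatsal2000.unramifiedKer, AddMonoidHom.mem_ker] at h
      rw [GreenbergVatsal2000.unramifiedKer, AddMonoidHom.mem_ker]
      have e := congrArg (fun f : Literature.NumberTheory.EllipticCurves.subgroupH1 H A →+
          discreteH1 (inertiaIn H v) B ↦ f (conjH1 H A σ x))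
        (res_inertiaIn_comp_resH1Hom_id H v j (fun _ a ↦ hj' _ a) (fun _ a ↦ hj' _ a))
      simp only [AddMonoidHom.comp_apply] at e
      rw [e] at h
      exact (injective_iff_map_eq_zero _).mp (hU v hvS hvp) _ h
    · by_cases hv𝔭 : v = 𝔭
      · -- at `𝔭`: all conjugates from the representatives
        subst hv𝔭
        rw [AcSelmer.bdpData_self p v hv, mem_strictKer_strictDatum_iff]
        refine hreps x (fun i hi ↦ ?_) σ
        exact congrFun hΨ ⟨i, hi⟩
      · rw [AcSelmer.bdpData_of_ne p 𝔭 hv hv𝔭, AcSelmer.strictKer_relaxedDatum_eq_top]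
        exact AddSubgroup.mem_top _
  -- (c) count through `g = Ψ|_Y`
  let g : Y →+ (Fin (p ^ c) → Literature.NumberTheory.EllipticCurves.subgroupH1 (H ⊓ decomp 𝔭) A) :=
    Ψ.comp Y.subtype
  -- the kernel of `g` injects into `R(A)`
  haveI hAfin : Finite (datumStrictSelmer H A p (AcSelmer.bdpData A p 𝔭) S₀) := hA.to_subtype
  have hkerA : ∀ r : g.ker, ((r : Y) : Literature.NumberTheory.EllipticCurves.subgroupH1 H A) ∈
      datumStrictSelmer H A p (AcSelmer.bdpData A p 𝔭) S₀ := fun r ↦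
    hΨzero _ (r : Y).2 ((AddMonoidHom.mem_ker).mp r.2)
  let ιK : g.ker → datumStrictSelmer H A p (AcSelmer.bdpData A p 𝔭) S₀ := fun r ↦ ⟨_, hkerA r⟩
  have hιK : Function.Injective ιK := fun r r' h ↦ by
    dsimp only [ιK] at h
    exact Subtype.ext (Subtype.ext (Subtype.mk.inj h))
  have hker_le : Nat.card g.ker ≤ Nat.card (datumStrictSelmer H A p (AcSelmer.bdpData A p 𝔭) S₀) :=
    Nat.card_le_card_of_injective ιK hιK
  -- the range of `g` injects into `T^{p^c}`
  haveI hTfin : Finite {y : Literature.NumberTheory.EllipticCurves.subgroupH1 (H ⊓ decomp 𝔭) A //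
      jD y = 0} := hT.to_subtype
  have hrangeT : ∀ z ∈ g.range, ∀ i : Fin (p ^ c), jD (z i) = 0 := by
    rintro _ ⟨r, rfl⟩ i
    exact hΨker _ (r : Y).2 i
  let ιR : g.range → (Fin (p ^ c) →
      {y : Literature.NumberTheory.EllipticCurves.subgroupH1 (H ⊓ decomp 𝔭) A // jD y = 0}) :=
    fun z i ↦ ⟨(z : Fin (p ^ c) → _) i, hrangeT _ z.2 i⟩
  have hιR : Function.Injective ιR := fun z z' h ↦ by
    apply Subtype.ext
    funext i
    have hi := congrFun h i
    dsimp only [ιR] at hi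
    exact Subtype.mk.inj hi
  have hrange_le : Nat.card g.range ≤
      Nat.card {y : Literature.NumberTheory.EllipticCurves.subgroupH1 (H ⊓ decomp 𝔭) A // jD y = 0} ^
        (p ^ c) := by
    rw [← natCard_fin_fun]
    exact Nat.card_le_card_of_injective ιR hιR
  have hcard : Nat.card Y = Nat.card g.ker * Nat.card g.range := natCard_eq_card_ker_mul_card_range g
  refine ⟨?_, ?_⟩
  · -- finiteness: both factors are finite and non-empty
    haveI : Finite g.ker := Finite.of_injective ιK hιK
    haveI : Finite g.range := Finite.of_injective ιR hιR
    refine Nat.finite_of_card_ne_zero ?_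
    rw [hcard]
    exact Nat.mul_ne_zero (Nat.card_pos (α := g.ker)).ne' (Nat.card_pos (α := g.range)).ne'
  · rw [hcard]
    exact Nat.mul_le_mul hker_le hrange_le

/-! ### §3 UPPER count: `#R(B) ≤ #R(A) · #R(C) · #C^{p^c}` -/

/-- **The residual dévissage, upper count: `#R_𝔭^Σ(K_∞, B) ≤ #R_𝔭^Σ(K_∞, A) · #R_𝔭^Σ(K_∞, C) · #C^{p^c}`**, for a
`Γ_K`-equivariant exact `0 → A —j→ B —q→ C → 0` of discrete `Γ_K`-modules with `C` FINITE (continuous orbit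
maps on `B`), `H = ker κ`, `p^c` representatives for the places of `K_∞` above `𝔭 ∋ p` (`hreps`), (U) at the good
places outside `Σ`, `R(A)` and `R(C)` finite. `q_*` maps `R(B)` into `R(C)`; its kernel on `R(B)` consists of
classes `j_* x`, `x ∈ j_*⁻¹ R(B)` (middle exactness of `H¹(H, A) → H¹(H, B) → H¹(H, C)`); §2 bounds
`#j_*⁻¹ R(B)` and §1 (at `G = H ⊓ D_𝔭`) bounds `#T ≤ #C`. UNCONDITIONAL: no surjectivity and no hypothesis at `𝔭`
on `C` — the count form of p628626's `finite_datumStrictSelmer_of_devissage_of_finite`.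
[cite: CastellaGrossiLeeSkinner2022, Prop. 17 (arXiv:2008.02571 §1.4)]
[cite: KellerYin2024, Thm. 1.4.1 and Lemma 1.4.4 (arXiv:2402.12781v2 §1.4)] [cite: SerreGaloisCohomology1997, I.§2.2] -/
theorem natCard_datumStrictSelmer_le_of_devissage [Finite C]
    (h𝔭 : ((p : ℕ) : 𝓞 K) ∈ 𝔭.asIdeal) (j : A →+ B)
    (hj' : ∀ (σ : absoluteGaloisGroup K) (a : A), j (σ • a) = σ • j a) (hinj : Function.Injective j)
    (q : B →+ C) (hq' : ∀ (σ : absoluteGaloisGroup K) (b : B), q (σ • b) = σ • q b)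
    (hsurj : Function.Surjective q) (hexact : ∀ b : B, q b = 0 → ∃ a : A, j a = b)
    (hcontB : ∀ b : B, Continuous fun g : absoluteGaloisGroup K ↦ g • b)
    (hU : ∀ v : HeightOneSpectrum (𝓞 K), v ∉ S₀ → ((p : ℕ) : 𝓞 K) ∉ v.asIdeal →
      Function.Injective
        (resH1Hom (ContinuousMonoidHom.id (inertiaIn κ.kerSubgroup v)) j (fun _ a ↦ hj' _ a)))
    (c : ℕ) (τ : ℕ → absoluteGaloisGroup K)
    (hreps : ∀ x : Literature.NumberTheory.EllipticCurves.subgroupH1 κ.kerSubgroup A,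
      (∀ i, i < p ^ c → resOfLe A (inf_le_left : κ.kerSubgroup ⊓ decomp 𝔭 ≤ κ.kerSubgroup)
        (conjH1 κ.kerSubgroup A (τ i) x) = 0) →
      ∀ σ : absoluteGaloisGroup K, resOfLe A (inf_le_left : κ.kerSubgroup ⊓ decomp 𝔭 ≤ κ.kerSubgroup)
        (conjH1 κ.kerSubgroup A σ x) = 0)
    (hA : (datumStrictSelmer κ.kerSubgroup A p (AcSelmer.bdpData A p 𝔭) S₀ :
      Set (Literature.NumberTheory.EllipticCurves.subgroupH1 κ.kerSubgroup A)).Finite)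
    (hC : (datumStrictSelmer κ.kerSubgroup C p (AcSelmer.bdpData C p 𝔭) S₀ :
      Set (Literature.NumberTheory.EllipticCurves.subgroupH1 κ.kerSubgroup C)).Finite) :
    Nat.card (datumStrictSelmer κ.kerSubgroup B p (AcSelmer.bdpData B p 𝔭) S₀) ≤
      Nat.card (datumStrictSelmer κ.kerSubgroup A p (AcSelmer.bdpData A p 𝔭) S₀) *
        Nat.card (datumStrictSelmer κ.kerSubgroup C p (AcSelmer.bdpData C p 𝔭) S₀) *
          Nat.card C ^ (p ^ c) := by
  let H := κ.kerSubgroup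
  let jH := resH1Hom (ContinuousMonoidHom.id H) j (fun _ a ↦ hj' _ a)
  let qH := resH1Hom (ContinuousMonoidHom.id H) q (fun _ b ↦ hq' _ b)
  let jD := resH1Hom (ContinuousMonoidHom.id ↥(H ⊓ decomp 𝔭)) j (fun _ a ↦ hj' _ a)
  have hcontH : ∀ b : B, Continuous fun g : H ↦ g • b := fun b ↦
    (hcontB b).comp continuous_subtype_val
  -- the local kernel `T` is finite with `#T ≤ #C`
  have hT : Set.Finite {y : Literature.NumberTheory.EllipticCurves.subgroupH1 (H ⊓ decomp 𝔭) A | jD y = 0} :=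
    finite_ker_resH1Hom_id_of_finite (G := ↥(H ⊓ decomp 𝔭)) j (fun _ a ↦ hj' _ a) hinj q hexact
  have hTle : Nat.card {y : Literature.NumberTheory.EllipticCurves.subgroupH1 (H ⊓ decomp 𝔭) A // jD y = 0} ≤
      Nat.card C :=
    natCard_ker_resH1Hom_id_le (G := ↥(H ⊓ decomp 𝔭)) j (fun _ a ↦ hj' _ a) hinj q hexact
  -- §2
  obtain ⟨hYfin, hYle⟩ := natCard_comap_datumStrictSelmer_le κ 𝔭 S₀ h𝔭 j hj' hU c τ hreps hT hA
  let Y : AddSubgroup (Literature.NumberTheory.EllipticCurves.subgroupH1 H A) :=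
    (datumStrictSelmer H B p (AcSelmer.bdpData B p 𝔭) S₀).comap jH
  haveI : Finite Y := hYfin
  -- count through `q_*|_{R(B)}`
  let RB := datumStrictSelmer H B p (AcSelmer.bdpData B p 𝔭) S₀
  let g' : RB →+ Literature.NumberTheory.EllipticCurves.subgroupH1 H C := qH.comp RB.subtype
  have hcard : Nat.card RB = Nat.card g'.ker * Nat.card g'.range := natCard_eq_card_ker_mul_card_range g'
  -- the range lies in `R(C)`
  haveI hCfin : Finite (datumStrictSelmer H C p (AcSelmer.bdpData C p 𝔭) S₀) := hC.to_subtype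
  have hrangeC : ∀ z ∈ g'.range, z ∈ datumStrictSelmer H C p (AcSelmer.bdpData C p 𝔭) S₀ := by
    rintro _ ⟨r, rfl⟩
    exact resH1Hom_id_mem_residualSelmer H p 𝔭 S₀ q hq' (fun _ b ↦ hq' _ b) r.2
  have hrange_le : Nat.card g'.range ≤ Nat.card (datumStrictSelmer H C p (AcSelmer.bdpData C p 𝔭) S₀) :=
    Nat.card_le_card_of_injective (fun z ↦ (⟨(z : Literature.NumberTheory.EllipticCurves.subgroupH1 H C),
      hrangeC _ z.2⟩ : datumStrictSelmer H C p (AcSelmer.bdpData C p 𝔭) S₀))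
      fun z z' h ↦ by
        dsimp only at h
        exact Subtype.ext (Subtype.mk.inj h)
  -- the kernel lies in `j_*(Y)`
  have hkerY : ∀ r : g'.ker, ∃ x : Y, jH (x : Literature.NumberTheory.EllipticCurves.subgroupH1 H A) =
      ((r : RB) : Literature.NumberTheory.EllipticCurves.subgroupH1 H B) := by
    intro r
    have hr : qH ((r : RB) : Literature.NumberTheory.EllipticCurves.subgroupH1 H B) = 0 :=
      (AddMonoidHom.mem_ker).mp r.2
    obtain ⟨x, hx⟩ := exists_resH1Hom_eq_of_resH1Hom_eq_zero (G := H) j (fun _ a ↦ hj' _ a) hinj q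
      (fun _ b ↦ hq' _ b) hsurj hexact hcontH hr
    have hxY : x ∈ Y := by
      change jH x ∈ RB
      rw [hx]; exact (r : RB).2
    exact ⟨⟨x, hxY⟩, hx⟩
  choose xr hxr using hkerY
  have hker_le : Nat.card g'.ker ≤ Nat.card Y := by
    refine Nat.card_le_card_of_injective xr fun r r' h ↦ ?_
    apply Subtype.ext; apply Subtype.ext
    rw [← hxr r, ← hxr r', h]
  -- assemble
  calc Nat.card RB = Nat.card g'.ker * Nat.card g'.range := hcard
    _ ≤ (Nat.card (datumStrictSelmer H A p (AcSelmer.bdpData A p 𝔭) S₀) * Nat.card C ^ (p ^ c)) *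
          Nat.card (datumStrictSelmer H C p (AcSelmer.bdpData C p 𝔭) S₀) := by
        refine Nat.mul_le_mul (hker_le.trans (hYle.trans ?_)) hrange_le
        exact Nat.mul_le_mul_left _ (Nat.pow_le_pow_left hTle _)
    _ = _ := by ring

end Residual

end Summit.BirchSwinnertonDyer.BirchSwinnertonDyer.Theorems.ResidualDevissageCount

end
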